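import Mathlib.NumberTheory.LSeries.DirichletContinuation
import Mathlib.NumberTheory.DirichletCharacter.Orthogonality
import Literature.NumberTheory.LFunctions.NoExceptionalZeroUpToTenPowTen
import HarnessLib

/-!
# Non-vanishing of Dirichlet `L`-functions at the central point in the presence of an
# exceptional character (Bui–Pratt–Zaharescu 2021, Theorem 1.1; Čech–Matomäki 2024, Theorem 2)

Topic `Literature/NumberTheory/LFunctions` (namespace `Literature.NumberTheory.LFunctions`).
STATEMENT LAYER for the cell `parity-realchar` (SIEGEL INSTRUMENT, deliverable "illusory-world
conditionals"; the non-vanishing line "[IS00, BPZ21, CM24]" of Lu–Zaman–Zhao's list of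
consequences of a hypothetical exceptional character): TWO named facts (D-0014), both printed as
UNCONDITIONAL inequalities whose error terms involve `L(1,ψ)` and are "non-trivial only in case an
exceptional character exists", and proved bookkeeping (the excluded range of the cell's tables).
Nothing here asserts that an exceptional character exists.

## What the sources print (held texts, read 2026-08-26)

* H. M. Bui, K. Pratt, A. Zaharescu, *Exceptional characters and nonvanishing of Dirichlet
  `L`-functions*, Math. Ann. 380 (2021) 593–642 = arXiv:2012.04392, **Theorem 1.1** (p. 3 of the
  held copy): "Let `C > 300` be a fixed real number. Let `D` be a positive, squarefree, fundamental
  discriminant, and let `ψ` be its associated real primitive character. Assume that `ψ` is even.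
  Then for any `ε > 0` and any prime `q` satisfying `D^{300} ≤ q ≤ D^C` we have
  `(1/φ(q)) Σ*_{χ (mod q), L(1/2,χ) ≠ 0} 1 ≥ 1/2 + O_{ε,C}(L(1,ψ)^{1/2}(log q)^{25/2+ε})
  + O_{ε,C}(L(1,ψ)(log q)^{25+ε}) + O_{ε,C}((log q)^{−1/2+ε})`" (`Σ*` over primitive characters).
* M. Čech, K. Matomäki, *A note on exceptional characters and non-vanishing of Dirichlet
  `L`-functions*, Math. Ann. 389 (2024) = arXiv:2303.05277, **Theorem 2** (p. 2 of the held copy):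
  "Let `ε > 0` be fixed. Let `D > 1` be a squarefree fundamental discriminant and let `ψ` be the
  associated primitive quadratic character modulo `D`. Let `C > 300` be fixed and let `q` be a prime
  such that `D^{300} ≤ q ≤ D^C`. Then, for any `δ > 0`,
  `(1/φ(q)) Σ_{χ mod q} 1_{|L(1/2,χ)| ≥ δ^{3/2}/(log q)^{9/2}} = 1 + O(δ^{−2} L(1,ψ)(log q)^{25+ε}
  + δ^{−2}/(log q)^{1−ε} + δ)`", "the implied constants are allowed to depend on `ε` and `C` (which
  are said to be fixed), but not on `D` or `q`"; **Corollary 1**: under `L(1,ψ) ≪ (log D)^{−25−ε}`,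
  `|{χ mod q : L(1/2,χ) ≠ 0}| = (1 + o(1))φ(q)` for such `q`.

## Lean rendering / design choices

* "`D > 1` a (positive) squarefree fundamental discriminant": `1 < D`, `Squarefree D`, `D % 4 = 1`
  (a positive fundamental discriminant that is square-free is `≡ 1 (mod 4)`); "its associated real
  primitive character" = any `ψ : DirichletCharacter ℂ D` with `ψ.IsPrimitive`, `ψ.IsQuadratic`
  (unique for such `D`); BPZ's "assume `ψ` is even" = `ψ.Even` (automatic for `D ≡ 1 (mod 4)`, kept
  as printed). `L(1,ψ)` (real, positive) is `‖ψ.LFunction 1‖`; `L(1/2, χ) = χ.LFunction (1/2)`.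
* Counting characters: `Nat.card` of a subtype of `DirichletCharacter ℂ q` (a finite type, Mathlib
  `DirichletCharacter.fintype`); `φ = Nat.totient`. BPZ's `Σ*` = primitive characters; ČM's `Σ` =
  all characters mod `q`.
* `O_{ε,C}(·)` with three terms = ONE constant `K = K(ε, C)` in front of the sum of the three
  printed quantities (equivalent); the left side of ČM's "`= 1 + O(…)`" is at most `1`, so it is
  rendered as the lower bound `≥ 1 − K(…)` (the upper bound `≤ 1` is trivial and omitted).
* Exponents `(log q)^{25/2+ε}` etc. are real powers `Real.log q ^ (25/2 + ε)`.

PROVED here: only the vacuity remark `centralValues_hypothesis_trivial_upTo_1e10` — for `D ≤ 10¹⁰`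
Lu–Zaman–Zhao's `L(1,ψ) ≥ 1/(8 log D)` (`luZamanZhao2026_corollary13`) makes the `L(1,ψ)`-terms
at least `(log q)^{25+ε}/(8 log D) ≥ (300/8)(log q)^{24+ε}` — i.e. the printed bounds are void of
content unless `D > 10¹⁰`, consistent with "non-trivial only in case an exceptional character
exists". WHAT THIS IS NOT: no non-vanishing theorem is claimed unconditionally beyond print; no
table refutes the hypothesis `L(1,ψ) ≪ (log D)^{−25−ε}` at large `D`.

## References

* [BuiPrattZaharescu2021] Theorem 1.1 (and Theorem 1.2, not typed).
* [CechMatomaki2024] Theorem 2, Corollary 1, Remark 1.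
* [LuZamanZhao2026] Corollary 1.3 (the excluded range).
-/

noncomputable section

namespace Literature.NumberTheory.LFunctions

/-! ### The named facts -/

/-- **Bui–Pratt–Zaharescu 2021, Theorem 1.1** (at least `1/2 − o(1)` of the `L(1/2, χ)`, `χ`
primitive mod a prime `q ∈ [D^{300}, D^C]`, are non-zero when `L(1,ψ)` is small): "Let `C > 300`
be a fixed real number. Let `D` be a positive, squarefree, fundamental discriminant, and let `ψ`
be its associated real primitive character. Assume that `ψ` is even. Then for any `ε > 0` and any
prime `q` satisfying `D^{300} ≤ q ≤ D^C` we have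
`(1/φ(q)) Σ*_{χ (mod q), L(1/2,χ) ≠ 0} 1 ≥ 1/2 + O_{ε,C}(L(1,ψ)^{1/2}(log q)^{25/2+ε}) + O_{ε,C}(L(1,ψ)(log q)^{25+ε}) + O_{ε,C}((log q)^{−1/2+ε})`."
Rendered with one constant `K(C, ε) > 0` for the three `O`-terms. NAMED FACT, not proved here.
[cite: BuiPrattZaharescu2021, Theorem 1.1] -/
def buiPrattZaharescu2021_theorem11 : Prop :=
  ∀ C : ℝ, 300 < C → ∀ ε : ℝ, 0 < ε → ∃ K : ℝ, 0 < K ∧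
    ∀ (D : ℕ) [NeZero D], 1 < D → Squarefree D → D % 4 = 1 →
      ∀ ψ : DirichletCharacter ℂ D, ψ.IsPrimitive → ψ.IsQuadratic → ψ.Even →
        ∀ (q : ℕ) [NeZero q], q.Prime → (D : ℝ) ^ (300 : ℕ) ≤ q → (q : ℝ) ≤ (D : ℝ) ^ C →
          1 / 2 - K * (‖ψ.LFunction 1‖ ^ ((1 : ℝ) / 2) * Real.log q ^ ((25 : ℝ) / 2 + ε) +
              ‖ψ.LFunction 1‖ * Real.log q ^ ((25 : ℝ) + ε) + Real.log q ^ (-(1 : ℝ) / 2 + ε)) ≤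
            (Nat.card {χ : DirichletCharacter ℂ q // χ.IsPrimitive ∧ χ.LFunction (1 / 2) ≠ 0} : ℝ) /
              (q.totient : ℝ)

/-- **Čech–Matomäki 2024, Theorem 2** (almost all `L(1/2, χ)`, `χ` mod a prime
`q ∈ [D^{300}, D^C]`, are `≥ δ^{3/2}/(log q)^{9/2}` in absolute value when `L(1,ψ)` is small): "Let
`ε > 0` be fixed. Let `D > 1` be a squarefree fundamental discriminant and let `ψ` be the associated
primitive quadratic character modulo `D`. Let `C > 300` be fixed and let `q` be a prime such that
`D^{300} ≤ q ≤ D^C`. Then, for any `δ > 0`,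
`(1/φ(q)) Σ_{χ mod q} 1_{|L(1/2,χ)| ≥ δ^{3/2}/(log q)^{9/2}} = 1 + O(δ^{−2} L(1,ψ)(log q)^{25+ε} + δ^{−2}/(log q)^{1−ε} + δ)`",
implied constants depending on `ε, C` only. Rendered as the lower bound with one constant
`K(ε, C) > 0` (the proportion is trivially `≤ 1`). NAMED FACT, not proved here.
[cite: CechMatomaki2024, Theorem 2] -/
def cechMatomaki2024_theorem2 : Prop :=
  ∀ ε : ℝ, 0 < ε → ∀ C : ℝ, 300 < C → ∃ K : ℝ, 0 < K ∧
    ∀ (D : ℕ) [NeZero D], 1 < D → Squarefree D → D % 4 = 1 →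
      ∀ ψ : DirichletCharacter ℂ D, ψ.IsPrimitive → ψ.IsQuadratic →
        ∀ (q : ℕ) [NeZero q], q.Prime → (D : ℝ) ^ (300 : ℕ) ≤ q → (q : ℝ) ≤ (D : ℝ) ^ C →
          ∀ δ : ℝ, 0 < δ →
            1 - K * (δ ^ (-(2 : ℝ)) * ‖ψ.LFunction 1‖ * Real.log q ^ ((25 : ℝ) + ε) +
                δ ^ (-(2 : ℝ)) / Real.log q ^ ((1 : ℝ) - ε) + δ) ≤
              (Nat.card {χ : DirichletCharacter ℂ q //
                  δ ^ ((3 : ℝ) / 2) / Real.log q ^ ((9 : ℝ) / 2) ≤ ‖χ.LFunction (1 / 2)‖} : ℝ) /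
                (q.totient : ℝ)

/-! ### Bookkeeping (proved): the moduli of the cell's tables carry no content -/

/-- For `q ≥ 3`, `1 < log q`. [folklore] -/
private theorem one_lt_log_of_three_le {q : ℕ} (hq : 3 ≤ q) : 1 < Real.log q := by
  have hq3 : (3 : ℝ) ≤ (q : ℝ) := by exact_mod_cast hq
  have hlog3 : 1 < Real.log 3 := by
    have h := Real.exp_one_lt_d9
    rw [Real.lt_log_iff_exp_lt (by norm_num)]
    linarith
  exact lt_of_lt_of_le hlog3 (Real.log_le_log (by norm_num) hq3)

/-- **Below `10¹⁰` the `L(1,ψ)`-term dominates.** Under Lu–Zaman–Zhao's Corollary 1.3, for a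
primitive quadratic `ψ` mod `3 ≤ D ≤ 10¹⁰` and any `q` with `D^{300} ≤ q` (so `log q ≥ 300 log D`):
`L(1,ψ)(log q)^{25+ε} ≥ (300/8)(log q)^{24+ε}` — in particular `≥ 300/8 > 1`, so the error terms in
`buiPrattZaharescu2021_theorem11` / `cechMatomaki2024_theorem2` exceed the main term `1/2` resp.
`1` for every admissible constant `K ≥ 1`: the printed bounds have content only for `D > 10¹⁰`.
We record the clean inequality `1 < ‖L(1,ψ)‖ (log q)^{25+ε}`. [cite: LuZamanZhao2026, Corollary 1.3] -/
theorem lOne_mul_log_pow_gt_one_upTo_1e10 (h13 : luZamanZhao2026_corollary13) {D : ℕ} [NeZero D]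
    (hD3 : 3 ≤ D) (hDQ : D ≤ 10 ^ 10) (ψ : DirichletCharacter ℂ D) (hprim : ψ.IsPrimitive)
    (hquad : ψ.IsQuadratic) {q : ℕ} (hq : (D : ℝ) ^ (300 : ℕ) ≤ q) {ε : ℝ} (hε : 0 < ε) :
    1 < ‖ψ.LFunction 1‖ * Real.log q ^ ((25 : ℝ) + ε) := by
  have hne : ψ ≠ 1 := SiegelZeroQuality.ne_one_of_isPrimitive hprim (by omega)
  have hlogD : 1 < Real.log D := one_lt_log_of_three_le hD3
  have hD0 : (0 : ℝ) < D := by exact_mod_cast (show 0 < D by omega)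
  -- `L(1,ψ) ≥ 1/(8 log D)`
  have hL : 1 / (8 * Real.log D) ≤ ‖ψ.LFunction 1‖ :=
    (h13 D hDQ ψ hquad hne hprim).trans (Complex.re_le_norm _)
  have hL0 : 0 < ‖ψ.LFunction 1‖ := lt_of_lt_of_le (by positivity) hL
  -- `log q ≥ 300 log D > 300`
  have hDpow : (0 : ℝ) < (D : ℝ) ^ (300 : ℕ) := by positivity
  have hq0 : (0 : ℝ) < q := lt_of_lt_of_le hDpow hq
  have hlogq : 300 * Real.log D ≤ Real.log q := by
    have := Real.log_le_log hDpow hq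
    rwa [Real.log_pow, Nat.cast_ofNat] at this
  have hlogq1 : 1 ≤ Real.log q := by nlinarith
  have hlogq300 : (300 : ℝ) * Real.log D ≤ Real.log q ^ ((25 : ℝ) + ε) := by
    calc (300 : ℝ) * Real.log D ≤ Real.log q := hlogq
      _ = Real.log q ^ (1 : ℝ) := (Real.rpow_one _).symm
      _ ≤ Real.log q ^ ((25 : ℝ) + ε) := Real.rpow_le_rpow_of_exponent_le hlogq1 (by linarith)
  -- combine: `‖L‖ · (log q)^{25+ε} ≥ (1/(8 log D)) · 300 log D = 300/8 > 1`
  have hpow0 : 0 ≤ Real.log q ^ ((25 : ℝ) + ε) := Real.rpow_nonneg (by linarith) _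
  have h1 : 1 / (8 * Real.log D) * (300 * Real.log D) ≤ ‖ψ.LFunction 1‖ * Real.log q ^ ((25 : ℝ) + ε) :=
    mul_le_mul hL hlogq300 (by nlinarith) hL0.le
  have h2 : 1 / (8 * Real.log D) * (300 * Real.log D) = 300 / 8 := by
    field_simp
  linarith

end Literature.NumberTheory.LFunctions

end
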